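import Mathlib
import Summits.Ventures.PercRepro2.Defs
import Summits.Ventures.PercRepro2.Independence
import Summits.Ventures.PercRepro2.Harris
import Summits.Ventures.PercRepro2.Graph
import Summits.Ventures.PercRepro2.Exploration
import Summits.Ventures.PercRepro2.Events
import Summits.Ventures.PercRepro2.Statements
import Summits.Ventures.PercRepro2.Statements2
import Summits.Ventures.PercRepro2.RestrictClosure
import Summits.Ventures.PercRepro2.SepPairDecomposition

/-!
# Theorem M2-5 in the vocabulary of the typed rows (blind cell PercRepro2, mine-2)

`SepPairDecomposition.lean` proves the first-hit decomposition across a separating pair with the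
events written out.  Here it is restated with the objects of `Events.lean` / `Statements2.lean`:
`Separates ends {a₁, a₂} o b`, the first-hit weights `firstHitWeight p ends o {a₁, a₂} a_i`
`= P(C(o) ∩ A = {a_i})` and the Green matrix `greenMatrix p ends o {a₁, a₂} a_i b`
`= P(o ↔ A, a_i ↔ b)` (KN24 §5.2):

`(h₁ + h₂) · P(o ↔ b) = h₁ · M_{a₁ b} + h₂ · M_{a₂ b}` — KN24 (38) holds with equality
(`kn38_eq_of_separates`).

The same conditional independence gives the **equality cases of the van den Berg–Kahn
inequality** (row R12 of `Statements2.lean`, mine-2's M2-3, the `⟸` direction): the conditional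
covariance `vdBKahnCov p ends s t a b` of `{s ↔ a}`, `{s ↔ b}` given `{s ↮ t}` vanishes whenever
`{s, t}` separates `a` from `b`, or `t` separates `s` from `a`, or `t` separates `s` from `b`
(`vdBKahnCov_eq_zero_of_separates`, `r12_mpr`).
-/

namespace Summit.Ventures.PercRepro2

section Bridge

variable {V : Type*} {E : Type*} [Fintype V] [DecidableEq V] [Fintype E] [DecidableEq E]

omit [Fintype E] [DecidableEq E] in
/-- `Separates ends {a₁, a₂} o b` in the form used by `SepPairDecomposition`: the configuration
of `Separates` is `sepConfig`. -/
lemma not_conn_sepConfig_of_separates {ends : E → Sym2 V} {a₁ a₂ o b : V}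
    (h : Separates ends {a₁, a₂} o b) :
    ¬ Conn ends (SepPair.sepConfig ends {a₁, a₂}) o b := by
  have hc : SepPair.sepConfig ends ({a₁, a₂} : Set V) =
      restrict (touches ends ↑({a₁, a₂} : Finset V))ᶜ (fun _ => true) := by
    funext e
    simp only [SepPair.sepConfig, restrict, Bool.true_and]
    refine decide_eq_decide.2 ?_
    rw [Set.mem_compl_iff, Finset.coe_insert, Finset.coe_singleton]
  rw [hc]
  exact h

omit [Fintype V] [Fintype E] [DecidableEq E] in
/-- `{o ↔ {a₁, a₂}} = {o ↔ a₁} ∪ {o ↔ a₂}`. -/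
lemma hitEvent_insert_singleton (ends : E → Sym2 V) (o a₁ a₂ : V) :
    hitEvent ends o {a₁, a₂} = connEvent ends o a₁ ∪ connEvent ends o a₂ := by
  ext ω
  simp [hitEvent, Finset.mem_insert, Finset.mem_singleton]

variable {R : Type*} [Field R] [LinearOrder R] [IsStrictOrderedRing R]

/-- **Theorem M2-5, KN24 (38) form.**  If `A = {a₁, a₂}` separates `o` from `b ∉ A`, then
`(h₁ + h₂) · P(o ↔ b) = h₁ · M_{a₁ b} + h₂ · M_{a₂ b}` with `h_i = P(C(o) ∩ A = {a_i})` and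
`M_{a b} = P(o ↔ A, a ↔ b)`: the Theorem-1 inequality of Kozma–Nitzan holds with equality. -/
theorem kn38_eq_of_separates {p : E → R} (hp : IsProbVec p) (ends : E → Sym2 V)
    {o a₁ a₂ b : V} (h12 : a₁ ≠ a₂) (ho : o ∉ ({a₁, a₂} : Finset V))
    (hb : b ∉ ({a₁, a₂} : Finset V)) (hsep : Separates ends {a₁, a₂} o b) :
    (firstHitWeight p ends o {a₁, a₂} a₁ + firstHitWeight p ends o {a₁, a₂} a₂) *
        prob p (connEvent ends o b) =
      firstHitWeight p ends o {a₁, a₂} a₁ * greenMatrix p ends o {a₁, a₂} a₁ b +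
        firstHitWeight p ends o {a₁, a₂} a₂ * greenMatrix p ends o {a₁, a₂} a₂ b := by
  have ho' : o ∉ ({a₁, a₂} : Set V) := by simpa using ho
  have hb' : b ∉ ({a₁, a₂} : Set V) := by simpa using hb
  unfold firstHitWeight greenMatrix
  rw [hitSetEvent_pair_left ends h12, hitSetEvent_pair_right ends h12, hitEvent_insert_singleton]
  exact SepPair.sepPair_firstHit_decomposition hp ends ho' hb' (not_conn_sepConfig_of_separates hsep)

omit [Fintype E] [DecidableEq E] in
/-- `Separates ends {t} s a` in `sepConfig` form. -/
lemma not_conn_sepConfig_singleton_of_separates {ends : E → Sym2 V} {t s a : V}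
    (h : Separates ends {t} s a) : ¬ Conn ends (SepPair.sepConfig ends {t}) s a := by
  have hc : SepPair.sepConfig ends ({t} : Set V) =
      restrict (touches ends ↑({t} : Finset V))ᶜ (fun _ => true) := by
    funext e
    simp only [SepPair.sepConfig, restrict, Bool.true_and]
    refine decide_eq_decide.2 ?_
    rw [Set.mem_compl_iff, Finset.coe_singleton]
  rw [hc]
  exact h

omit [Fintype V] [DecidableEq V] [Fintype E] [DecidableEq E] in
/-- If `s ↔ a` but `s ↮ t`, then `s ↔ a` already in `G − t`. -/
lemma conn_sepConfig_singleton_of_not_conn {ends : E → Sym2 V} {ω : Config E} {s t a : V}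
    (hst : ¬ Conn ends ω s t) (h : Conn ends ω s a) :
    Conn ends (SepPair.sepConfig ends {t}) s a := by
  classical
  -- the connection lives inside the edges not touching `t`
  have key : Conn ends (SepPair.restrictTo (touches ends ({t} : Set V))ᶜ ω) s a := by
    refine SepPair.mem_of_conn_of_closed'
      (S := cluster ends (SepPair.restrictTo (touches ends ({t} : Set V))ᶜ ω) s) ?_
      (mem_cluster_self _ _ _) h
    intro e x y he hends hx
    by_cases heF : e ∈ (touches ends ({t} : Set V))ᶜ
    · exact conn_trans hx (conn_of_openAdj ⟨e, SepPair.restrictTo_eq_true_of_mem heF he, hends⟩)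
    · exfalso
      obtain ⟨x', hx', y', h'⟩ : e ∈ touches ends ({t} : Set V) := by simpa using heF
      rw [Set.mem_singleton_iff] at hx'
      subst hx'
      rw [hends, Sym2.eq_iff] at h'
      rcases h' with ⟨rfl, _⟩ | ⟨_, rfl⟩
      · exact hst (SepPair.conn_of_conn_restrictTo hx)
      · exact hst (conn_trans (SepPair.conn_of_conn_restrictTo hx) (conn_of_openAdj ⟨e, he, hends⟩))
  refine conn_mono ?_ key
  intro e
  by_cases heF : e ∈ (touches ends ({t} : Set V))ᶜ
  · rw [SepPair.sepConfig_eq_true heF]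
    exact Bool.le_true _
  · rw [SepPair.restrictTo_apply_of_notMem heF]
    exact Bool.false_le _

omit [LinearOrder R] [IsStrictOrderedRing R] in
/-- **Equality cases of the van den Berg–Kahn inequality (M2-3, `⟸`).**  The conditional
covariance of `{s ↔ a}` and `{s ↔ b}` given `{s ↮ t}` vanishes when `{s, t}` separates `a`
from `b`, or `t` separates `s` from `a`, or `t` separates `s` from `b`. -/
theorem vdBKahnCov_eq_zero_of_separates (p : E → R) (ends : E → Sym2 V) {s t a b : V}
    (ha : a ∉ ({s, t} : Finset V))
    (h : Separates ends {s, t} a b ∨ Separates ends {t} s a ∨ Separates ends {t} s b) :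
    vdBKahnCov p ends s t a b = 0 := by
  unfold vdBKahnCov
  rcases h with h | h | h
  · -- `{s, t}` separates `a` from `b`: conditional independence across the pair `{s, t}`
    have ha' : a ∉ ({s, t} : Set V) := by simpa using ha
    have key := SepPair.prob_conn_inter_mul p ends ha' (not_conn_sepConfig_of_separates h)
      (Or.inl rfl : s = s ∨ s = t) (Or.inl rfl : s = s ∨ s = t)
    rw [connEvent_comm ends a s] at key
    exact sub_eq_zero.2 key
  · -- `t` separates `s` from `a`: `{s ↔ a, s ↮ t}` is empty
    have hempty : connEvent ends s a ∩ (connEvent ends s t)ᶜ = ∅ := by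
      ext ω
      simp only [Set.mem_inter_iff, Set.mem_compl_iff, mem_connEvent, Set.mem_empty_iff_false,
        iff_false, not_and, not_not]
      intro hsa
      by_contra hst
      exact not_conn_sepConfig_singleton_of_separates h
        (conn_sepConfig_singleton_of_not_conn hst hsa)
    have hempty' : connEvent ends s a ∩ connEvent ends s b ∩ (connEvent ends s t)ᶜ = ∅ := by
      rw [Set.inter_right_comm, hempty, Set.empty_inter]
    rw [hempty, hempty', prob_empty]
    ring
  · -- `t` separates `s` from `b`: `{s ↔ b, s ↮ t}` is empty
    have hempty : connEvent ends s b ∩ (connEvent ends s t)ᶜ = ∅ := by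
      ext ω
      simp only [Set.mem_inter_iff, Set.mem_compl_iff, mem_connEvent, Set.mem_empty_iff_false,
        iff_false, not_and, not_not]
      intro hsb
      by_contra hst
      exact not_conn_sepConfig_singleton_of_separates h
        (conn_sepConfig_singleton_of_not_conn hst hsb)
    have hempty' : connEvent ends s a ∩ connEvent ends s b ∩ (connEvent ends s t)ᶜ = ∅ := by
      rw [Set.inter_assoc, hempty, Set.inter_empty]
    rw [hempty, hempty', prob_empty]
    ring

omit [IsStrictOrderedRing R] in
/-- The proved half of row R12 (`Statements2.lean`): separation forces the vdB–Kahn covariance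
to vanish for every uniform weight `q`. -/
theorem r12_mpr (ends : E → Sym2 V) {s t a b : V} (ha : a ∉ ({s, t} : Finset V))
    (h : Separates ends {s, t} a b ∨ Separates ends {t} s a ∨ Separates ends {t} s b) :
    ∀ q : R, 0 < q → q < 1 → vdBKahnCov (fun _ => q) ends s t a b = 0 :=
  fun q _ _ => vdBKahnCov_eq_zero_of_separates (fun _ => q) ends ha h


/-! ## Corollary: a shielded third point carries Theorem-11 weight `0` and the visible pair sums to `1` -/

omit [Fintype E] [DecidableEq E] in
/-- Shielding: if `{a₁, a₂}` separates `o` from `a₃`, the hit event of `{a₁, a₂, a₃}` is that of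
`{a₁, a₂}`. -/
lemma hitEvent_insert_of_separates {ends : E → Sym2 V} {o a₁ a₂ a₃ : V}
    (ho : o ∉ ({a₁, a₂} : Finset V)) (h₃ : a₃ ∉ ({a₁, a₂} : Finset V))
    (hsep : Separates ends {a₁, a₂} o a₃) :
    hitEvent ends o {a₁, a₂, a₃} = hitEvent ends o {a₁, a₂} := by
  have ho' : o ∉ ({a₁, a₂} : Set V) := by simpa using ho
  have h₃' : a₃ ∉ ({a₁, a₂} : Set V) := by simpa using h₃
  ext ω
  simp only [mem_hitEvent, Finset.mem_insert, Finset.mem_singleton]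
  constructor
  · rintro ⟨a, ha, hc⟩
    rcases ha with rfl | rfl | rfl
    · exact ⟨a, Or.inl rfl, hc⟩
    · exact ⟨a, Or.inr rfl, hc⟩
    · rcases SepPair.conn_pair_of_conn ho' h₃' (not_conn_sepConfig_of_separates hsep) hc with h | h
      · exact ⟨a₁, Or.inl rfl, h⟩
      · exact ⟨a₂, Or.inr rfl, h⟩
  · rintro ⟨a, ha, hc⟩
    rcases ha with rfl | rfl
    · exact ⟨a, Or.inl rfl, hc⟩
    · exact ⟨a, Or.inr (Or.inl rfl), hc⟩

omit [Fintype V] [DecidableEq V] [Fintype E] [DecidableEq E] in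
/-- `{o ↔ a₁} ∪ {o ↔ a₂}` meets `{a₁ ↔ a₂}` exactly in `{o ↔ a₁} ∩ {o ↔ a₂}`. -/
lemma union_inter_connEvent_pair (ends : E → Sym2 V) (o a₁ a₂ : V) :
    (connEvent ends o a₁ ∪ connEvent ends o a₂) ∩ connEvent ends a₁ a₂ =
      connEvent ends o a₁ ∩ connEvent ends o a₂ := by
  ext ω
  simp only [Set.mem_inter_iff, Set.mem_union, mem_connEvent]
  constructor
  · rintro ⟨h | h, h12⟩
    · exact ⟨h, conn_trans h h12⟩
    · exact ⟨conn_trans h (conn_symm h12), h⟩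
  · rintro ⟨h1, h2⟩
    exact ⟨Or.inl h1, conn_trans (conn_symm h1) h2⟩

omit [Fintype V] [DecidableEq V] in
/-- The `|A| = 2` Theorem-11 identity at a visible point:
`(h₁ + h₂) · P(o ↔ a₁) = h₁ · P(o ↔ A) + h₂ · P(o ↔ A, a₁ ↔ a₂)` with `A = {a₁, a₂}`. -/
lemma pair_t11_row (p : E → R) (ends : E → Sym2 V) (o a₁ a₂ : V) :
    (prob p (connEvent ends o a₁ ∩ (connEvent ends o a₂)ᶜ) +
        prob p (connEvent ends o a₂ ∩ (connEvent ends o a₁)ᶜ)) * prob p (connEvent ends o a₁) =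
      prob p (connEvent ends o a₁ ∩ (connEvent ends o a₂)ᶜ) *
          prob p (connEvent ends o a₁ ∪ connEvent ends o a₂) +
        prob p (connEvent ends o a₂ ∩ (connEvent ends o a₁)ᶜ) *
          prob p ((connEvent ends o a₁ ∪ connEvent ends o a₂) ∩ connEvent ends a₁ a₂) := by
  rw [union_inter_connEvent_pair]
  have e1 := prob_inter_add_prob_inter_compl p (connEvent ends o a₁) (connEvent ends o a₂)
  have e2 := prob_inter_add_prob_inter_compl p (connEvent ends o a₂) (connEvent ends o a₁)
  have e3 := prob_union_add_prob_inter p (connEvent ends o a₁) (connEvent ends o a₂)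
  rw [Set.inter_comm (connEvent ends o a₂) (connEvent ends o a₁)] at e2
  linear_combination -(prob p (connEvent ends o a₂ ∩ (connEvent ends o a₁)ᶜ)) * e1 +
    prob p (connEvent ends o a₁ ∩ (connEvent ends o a₂)ᶜ) * e2 -
    prob p (connEvent ends o a₁ ∩ (connEvent ends o a₂)ᶜ) * e3

/-- **Corollary of M2-5 (PROOF-M2-5 corollary, |A| = 3 with one shielded point).**  If `a₃` is
shielded by `{a₁, a₂}` (the pair separates `o` from `a₃`) and the first-hit weights
`h₁ + h₂ ≠ 0`, then `c = (h₁, h₂, 0) / (h₁ + h₂)` is a Theorem-11 coefficient vector for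
`A = {a₁, a₂, a₃}`: it is supported on the visible pair and `Σ_a c_a = 1`. -/
theorem isT11Coeff_of_separates {p : E → R} (hp : IsProbVec p) (ends : E → Sym2 V)
    {o a₁ a₂ a₃ : V} (h12 : a₁ ≠ a₂) (ho : o ∉ ({a₁, a₂} : Finset V))
    (h₃ : a₃ ∉ ({a₁, a₂} : Finset V)) (hsep : Separates ends {a₁, a₂} o a₃)
    (hH : firstHitWeight p ends o {a₁, a₂} a₁ + firstHitWeight p ends o {a₁, a₂} a₂ ≠ 0) :
    IsT11Coeff p ends o {a₁, a₂, a₃} (fun a =>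
      if a = a₁ then firstHitWeight p ends o {a₁, a₂} a₁ /
          (firstHitWeight p ends o {a₁, a₂} a₁ + firstHitWeight p ends o {a₁, a₂} a₂)
      else if a = a₂ then firstHitWeight p ends o {a₁, a₂} a₂ /
          (firstHitWeight p ends o {a₁, a₂} a₁ + firstHitWeight p ends o {a₁, a₂} a₂)
      else 0) ∧
    ∑ a ∈ ({a₁, a₂, a₃} : Finset V), (fun a =>
      if a = a₁ then firstHitWeight p ends o {a₁, a₂} a₁ /
          (firstHitWeight p ends o {a₁, a₂} a₁ + firstHitWeight p ends o {a₁, a₂} a₂)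
      else if a = a₂ then firstHitWeight p ends o {a₁, a₂} a₂ /
          (firstHitWeight p ends o {a₁, a₂} a₁ + firstHitWeight p ends o {a₁, a₂} a₂)
      else 0) a = 1 := by
  have h13 : a₁ ≠ a₃ := fun h => h₃ (by simp [h])
  have h23 : a₂ ≠ a₃ := fun h => h₃ (by simp [h])
  have hA : hitEvent ends o {a₁, a₂, a₃} = hitEvent ends o {a₁, a₂} :=
    hitEvent_insert_of_separates ho h₃ hsep
  -- the two first-hit weights in event form
  have e₁ : firstHitWeight p ends o {a₁, a₂} a₁ =
      prob p (connEvent ends o a₁ ∩ (connEvent ends o a₂)ᶜ) := by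
    unfold firstHitWeight; rw [hitSetEvent_pair_left ends h12]
  have e₂ : firstHitWeight p ends o {a₁, a₂} a₂ =
      prob p (connEvent ends o a₂ ∩ (connEvent ends o a₁)ᶜ) := by
    unfold firstHitWeight; rw [hitSetEvent_pair_right ends h12]
  have hsum : ∀ f : V → R, ∑ a ∈ ({a₁, a₂, a₃} : Finset V), f a = f a₁ + f a₂ + f a₃ := by
    intro f
    rw [Finset.sum_insert (by simp [h12, h13]), Finset.sum_insert (by simp [h23]),
      Finset.sum_singleton, add_assoc]
  have hu₁ : connEvent ends a₁ a₁ = Set.univ := Set.eq_univ_of_forall fun ω => conn_refl ends ω a₁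
  have hu₂ : connEvent ends a₂ a₂ = Set.univ := Set.eq_univ_of_forall fun ω => conn_refl ends ω a₂
  refine ⟨?_, ?_⟩
  · intro a' ha'
    rw [hsum]
    simp only [if_true, if_neg h12.symm, if_neg h13.symm, if_neg h23.symm, zero_mul, add_zero]
    unfold greenMatrix
    rw [hA, hitEvent_insert_singleton]
    simp only [Finset.mem_insert, Finset.mem_singleton] at ha'
    rcases ha' with h | h | h <;> rw [h]
    · -- the row of the visible point `a₁`
      rw [hu₁, Set.inter_univ, connEvent_comm ends a₂ a₁]
      have pr := pair_t11_row p ends o a₁ a₂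
      rw [← e₁, ← e₂] at pr
      rw [div_mul_eq_mul_div, div_mul_eq_mul_div, ← add_div, div_eq_iff hH]
      linear_combination -pr
    · -- the row of the visible point `a₂`
      rw [hu₂, Set.inter_univ]
      have pr := pair_t11_row p ends o a₂ a₁
      rw [← e₁, ← e₂, Set.union_comm, connEvent_comm ends a₂ a₁] at pr
      rw [div_mul_eq_mul_div, div_mul_eq_mul_div, ← add_div, div_eq_iff hH]
      linear_combination -pr
    · -- the row of the shielded point `a₃`: Theorem M2-5
      have key := kn38_eq_of_separates hp ends h12 ho h₃ hsep
      unfold greenMatrix at key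
      rw [hitEvent_insert_singleton] at key
      rw [div_mul_eq_mul_div, div_mul_eq_mul_div, ← add_div, div_eq_iff hH]
      linear_combination -key
  · rw [hsum]
    simp only [if_true, if_neg h12.symm, if_neg h13.symm, if_neg h23.symm, add_zero]
    rw [← add_div, div_self hH]
end Bridge

end Summit.Ventures.PercRepro2
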